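import Summits.AtomisticToContinuum.HydrodynamicLimit.Theses.CompensatedSlabClusters

/-!
# `PayloadClosure` (stmt-AtomisticToContinuum-9053) — the costume theorems

Crux-strategist r1 evidence for route `route-AtomisticToContinuum-CompensatedSlabClusters`
(REDIRECT pass, 2026-08-17). Sorry-free; every theorem below is kernel-checked against the live route
file `Theses/CompensatedSlabClusters.lean` (rev 11).

The crux is, by `Iff.rfl`, the implication MODULE ⟶ WAYPOINT:
`PayloadClosure ↔ (CollisionPayloadTight → L2HydroFields)`, where

* `CollisionPayloadTight` (support 9054) is the route's OWN a-priori module — the deliverable of its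
  other three `closes` binders (`module_gives_tight` : the binders h₁ h₂ h₃ of `closes` yield it);
* `L2HydroFields` (support 9057 = shared waypoint stmt-0800 verbatim) is the UNGUARDED mean-square
  hydrodynamic limit: it implies the PRE-RETYPE Literature conjecture
  `Literature.MathematicalPhysics.KineticTheory.HydrodynamicLimit` (`unguarded_of_waypoint`, Chebyshev),
  which the statement audit of 2026-08-16 (§2.28, D-0032) found OVER-STRONG (σ₀ fixed before
  `∀ T ∀ solution`: imploding classical solutions silently covered) and which the human REPLACED by the
  packing-guarded conjunct `_root_.HydrodynamicLimit` (`HydrodynamicLimit.of_unguarded` : old ⇒ new).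

Hence (`costume`): on the route's own module the crux IS the waypoint, and the waypoint is at least the
old, strictly-stronger-typed summit. The crux's only hypothesis is an a-priori tightness bound that does
not touch the closure / local-equilibrium content (BoltzmannHypothesisBarrier — conceded in the route
header: "crux 4 does not evade it by itself"). Dominating hypothesis in the tribunal's T1 sense:
`payloadClosure_of_waypoint : L2HydroFields → PayloadClosure` with `summit_of_waypoint : L2HydroFields →
_root_.HydrodynamicLimit`.
-/

namespace Summit.AtomisticToContinuum.HydrodynamicLimit.Cruxes.PayloadClosure

open scoped BigOperators Topology Classical MeasureTheory ProbabilityTheory InnerProductSpace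
open Filter Set Function TopologicalSpace MeasureTheory
open Summit.AtomisticToContinuum.HydrodynamicLimit.Theses.CompensatedSlabClusters

/-- The crux is literally "module ⟶ shared unguarded waypoint". -/
theorem payloadClosure_iff_module_to_waypoint :
    PayloadClosure ↔ (CollisionPayloadTight → L2HydroFields) := Iff.rfl

/-- Dominating hypothesis (tribunal T1 shape): the shared waypoint alone gives the crux. -/
theorem payloadClosure_of_waypoint (h : L2HydroFields) : PayloadClosure := fun _ => h

/-- The other three binders of the route's `closes` deliver the module (this is `have hL2 := h₄ (h₃ h₁ h₂)`
in `closes`, first half). -/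
theorem module_gives_tight (h₁ : SerrePeriodicPayload) (h₂ : ClusterFourthMoment)
    (h₃ : PayloadOfClusters) : CollisionPayloadTight := h₃ h₁ h₂

/-- On the route's own module the crux IS the waypoint. -/
theorem payloadClosure_iff_waypoint (hR : CollisionPayloadTight) : PayloadClosure ↔ L2HydroFields :=
  ⟨fun h => h hR, fun h _ => h⟩

/-- The waypoint implies the PRE-RETYPE (unguarded) Literature conjecture — Chebyshev–Markov in `ℝ≥0∞`
plus measurability of the tested empirical fields; the same ninety lines as the route's `closes`, but
concluding the OLD summit `Literature.MathematicalPhysics.KineticTheory.HydrodynamicLimit`, for ALL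
classical solutions and all `T` (no packing guard anywhere). -/
theorem unguarded_of_waypoint (hL2 : L2HydroFields) :
    Literature.MathematicalPhysics.KineticTheory.HydrodynamicLimit := by
  have cheb : ∀ (P : (N : ℕ) → Measure (Literature.Analysis.FluidPDE.Config (N + 1) (Fin 3)
        Literature.MathematicalPhysics.KineticTheory.T3))
      (g : (N : ℕ) → Literature.Analysis.FluidPDE.Config (N + 1) (Fin 3)
        Literature.MathematicalPhysics.KineticTheory.T3 → ℝ),
      (∀ N, Measurable (g N)) →
      Tendsto (fun N => ∫⁻ z, ENNReal.ofReal (g N z ^ 2) ∂P N) atTop (𝓝 0) →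
      ∀ δ : ℝ, 0 < δ → Tendsto (fun N => P N {z | δ < g N z}) atTop (𝓝 0) := by
    intro P g hg h δ hδ
    have hδ2 : ENNReal.ofReal (δ ^ 2) ≠ 0 := by
      rw [Ne, ENNReal.ofReal_eq_zero, not_le]
      positivity
    have hlim : Tendsto (fun N => (∫⁻ z, ENNReal.ofReal (g N z ^ 2) ∂P N) / ENNReal.ofReal (δ ^ 2))
        atTop (𝓝 0) := by
      simpa only [ENNReal.zero_div] using ENNReal.Tendsto.div_const h (Or.inr hδ2)
    refine tendsto_of_tendsto_of_tendsto_of_le_of_le tendsto_const_nhds hlim (fun _ => zero_le)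
      fun N => ?_
    calc P N {z | δ < g N z}
        ≤ P N {z | ENNReal.ofReal (δ ^ 2) ≤ ENNReal.ofReal (g N z ^ 2)} := by
          refine measure_mono fun z hz => ?_
          simp only [mem_setOf_eq] at hz ⊢
          refine ENNReal.ofReal_le_ofReal ?_
          have h0 : 0 ≤ δ := hδ.le
          nlinarith
      _ ≤ (∫⁻ z, ENNReal.ofReal (g N z ^ 2) ∂P N) / ENNReal.ofReal (δ ^ 2) :=
          meas_ge_le_lintegral_div ((hg N).pow_const 2).ennreal_ofReal.aemeasurable hδ2
            ENNReal.ofReal_ne_top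
  have hpos : ∀ {N : ℕ} (i : Fin N), Measurable fun z : Literature.Analysis.FluidPDE.Config N (Fin 3)
      Literature.MathematicalPhysics.KineticTheory.T3 => (z i).1 :=
    fun i => (measurable_pi_apply i).fst
  have hvel : ∀ {N : ℕ} (i : Fin N), Measurable fun z : Literature.Analysis.FluidPDE.Config N (Fin 3)
      Literature.MathematicalPhysics.KineticTheory.T3 => (z i).2 :=
    fun i => (measurable_pi_apply i).snd
  have hint : ∀ {N : ℕ} {E : Type} [NormedAddCommGroup E] [NormedSpace ℝ E] [CompleteSpace E]
      (F : Literature.MathematicalPhysics.KineticTheory.T3 × Literature.MathematicalPhysics.KineticTheory.V3 → E)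
      (z : Literature.Analysis.FluidPDE.Config N (Fin 3) Literature.MathematicalPhysics.KineticTheory.T3),
      ∫ y, F y ∂Literature.Analysis.FluidPDE.empiricalMeasure z = ((N : ENNReal)⁻¹).toReal • ∑ i, F (z i) := by
    intro N E _ _ _ F z
    rw [Literature.Analysis.FluidPDE.empiricalMeasure_eq, integral_smul_measure,
      integral_finsetSum_measure fun i _ => integrable_dirac enorm_lt_top]
    simp [integral_dirac]
  have mD : ∀ {N : ℕ} {χ : Literature.MathematicalPhysics.KineticTheory.T3 → ℝ}, Continuous χ →
      Measurable fun z : Literature.Analysis.FluidPDE.Config N (Fin 3)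
        Literature.MathematicalPhysics.KineticTheory.T3 =>
        Literature.MathematicalPhysics.KineticTheory.empiricalDensityField z χ := by
    intro N χ hχ
    have : (fun z : Literature.Analysis.FluidPDE.Config N (Fin 3)
        Literature.MathematicalPhysics.KineticTheory.T3 =>
        Literature.MathematicalPhysics.KineticTheory.empiricalDensityField z χ) =
        fun z => ((N : ENNReal)⁻¹).toReal * ∑ i, χ (z i).1 := by
      funext z; exact (hint (fun y => χ y.1) z).trans (smul_eq_mul _ _)
    rw [this]
    exact measurable_const.mul (Finset.measurable_sum _ fun i _ => hχ.measurable.comp (hpos i))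
  have mM : ∀ {N : ℕ} {χ : Literature.MathematicalPhysics.KineticTheory.T3 → ℝ}, Continuous χ →
      Measurable fun z : Literature.Analysis.FluidPDE.Config N (Fin 3)
        Literature.MathematicalPhysics.KineticTheory.T3 =>
        Literature.MathematicalPhysics.KineticTheory.empiricalMomentumField z χ := by
    intro N χ hχ
    have : (fun z : Literature.Analysis.FluidPDE.Config N (Fin 3)
        Literature.MathematicalPhysics.KineticTheory.T3 =>
        Literature.MathematicalPhysics.KineticTheory.empiricalMomentumField z χ) =
        fun z => ((N : ENNReal)⁻¹).toReal • ∑ i, χ (z i).1 • (z i).2 := by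
      funext z; exact hint (fun y => χ y.1 • y.2) z
    rw [this]
    exact (Finset.measurable_sum _ fun i _ =>
      (hχ.measurable.comp (hpos i)).smul (hvel i)).const_smul (((N : ENNReal)⁻¹).toReal)
  have mE : ∀ {N : ℕ} {χ : Literature.MathematicalPhysics.KineticTheory.T3 → ℝ}, Continuous χ →
      Measurable fun z : Literature.Analysis.FluidPDE.Config N (Fin 3)
        Literature.MathematicalPhysics.KineticTheory.T3 =>
        Literature.MathematicalPhysics.KineticTheory.empiricalEnergyField z χ := by
    intro N χ hχ
    have : (fun z : Literature.Analysis.FluidPDE.Config N (Fin 3)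
        Literature.MathematicalPhysics.KineticTheory.T3 =>
        Literature.MathematicalPhysics.KineticTheory.empiricalEnergyField z χ) =
        fun z => ((N : ENNReal)⁻¹).toReal * ∑ i, χ (z i).1 * (‖(z i).2‖ ^ 2 / 2) := by
      funext z; exact (hint (fun y => χ y.1 * (‖y.2‖ ^ 2 / 2)) z).trans (smul_eq_mul _ _)
    rw [this]
    exact measurable_const.mul (Finset.measurable_sum _ fun i _ =>
      (hχ.measurable.comp (hpos i)).mul (((hvel i).norm.pow_const 2).div_const 2))
  -- the unguarded conjecture, profile by profile, for EVERY classical solution and every T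
  intro a₀ θ₀ u₀ ha hθ hu ha0 hθ0
  obtain ⟨σ₀, hσ₀, H⟩ := hL2 a₀ θ₀ u₀ ha hθ hu ha0 hθ0
  refine ⟨σ₀, hσ₀, fun σ hσ hσ' T ρ θ u hsol Φ h0 t ht => ?_⟩
  intro χ hχ δ hδ
  obtain ⟨c₁, c₂, c₃⟩ := H σ hσ hσ' T ρ θ u hsol Φ h0 t ht χ hχ
  refine ⟨?_, ?_, ?_⟩
  · exact cheb _ (fun N z => |Literature.MathematicalPhysics.KineticTheory.empiricalDensityField
        ((Φ N).flow t z) χ - ∫ x, χ x * ρ t x|)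
      (fun N => (((mD hχ).comp ((Φ N).measurable_flow t)).sub_const _).abs) c₁ δ hδ
  · exact cheb _ (fun N z => ‖Literature.MathematicalPhysics.KineticTheory.empiricalMomentumField
        ((Φ N).flow t z) χ - ∫ x, (χ x * ρ t x) • u t x‖)
      (fun N => (((mM hχ).comp ((Φ N).measurable_flow t)).sub_const _).norm) c₂ δ hδ
  · exact cheb _ (fun N z => |Literature.MathematicalPhysics.KineticTheory.empiricalEnergyField
        ((Φ N).flow t z) χ - ∫ x, χ x *
          Literature.MathematicalPhysics.KineticTheory.totalEnergyDensity (ρ t x) (u t x) (θ t x)|)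
      (fun N => (((mE hχ).comp ((Φ N).measurable_flow t)).sub_const _).abs) c₃ δ hδ

/-- … hence the waypoint gives the (re-typed, packing-guarded) summit conjunct too. -/
theorem summit_of_waypoint (hL2 : L2HydroFields) : _root_.HydrodynamicLimit :=
  HydrodynamicLimit.of_unguarded (unguarded_of_waypoint hL2)

/-- On the module, the crux delivers the OLD, unguarded summit (strictly stronger typing than S). -/
theorem unguarded_of_payloadClosure (hR : CollisionPayloadTight) (h : PayloadClosure) :
    Literature.MathematicalPhysics.KineticTheory.HydrodynamicLimit :=
  unguarded_of_waypoint (h hR)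

/-- **Costume theorem.** Given the route's own a-priori module `CollisionPayloadTight` — which the
other three binders of `closes` exist to deliver and which carries none of the closure content — the
crux `PayloadClosure` is EQUIVALENT to the shared unguarded waypoint `L2HydroFields`, and therefore
implies the pre-retype Literature conjecture (σ₀ before ∀ T ∀ solution, found over-strong by the
2026-08-16 statement audit) and a fortiori the summit conjunct `_root_.HydrodynamicLimit`. -/
theorem costume (hR : CollisionPayloadTight) :
    (PayloadClosure ↔ L2HydroFields) ∧
      (PayloadClosure → Literature.MathematicalPhysics.KineticTheory.HydrodynamicLimit) ∧
      (PayloadClosure → _root_.HydrodynamicLimit) :=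
  ⟨payloadClosure_iff_waypoint hR, fun h => unguarded_of_waypoint (h hR),
    fun h => summit_of_waypoint (h hR)⟩

/-- The same fact in `closes` shape: replacing the binder `h₄ : PayloadClosure` by the waypoint changes
nothing, and with it the route decides not just the conjunct but the OLD unguarded conjecture. -/
theorem closes_unguarded (h₁ : SerrePeriodicPayload) (h₂ : ClusterFourthMoment) (h₃ : PayloadOfClusters)
    (h₄ : PayloadClosure) : Literature.MathematicalPhysics.KineticTheory.HydrodynamicLimit :=
  unguarded_of_payloadClosure (module_gives_tight h₁ h₂ h₃) h₄

end Summit.AtomisticToContinuum.HydrodynamicLimit.Cruxes.PayloadClosure
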